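import Literature.Probability.RandomPlanarGeometry.RestrictionMeasuresFiveEighthsThreeLeaves
import HarnessLib

/-!
# [LSW] Cor. 8.6 from a two-sided `P_1` charging the interior event with POSITIVE probability

Proof-only companion (no definition, no named fact) of `RestrictionMeasuresFiveEighthsThreeLeaves`
and `OneSidedExcursionCloudMeasure` for the named fact
`Literature.Probability.RandomPlanarGeometry.not_exists_isRestrictionMeasure_of_lt_five_eighths`
([LSW] Cor. 8.6: "For all `α < 5/8`, the two-sided restriction probability measure `P_α` does
not exist"), after

* G. F. Lawler, O. Schramm, W. Werner, *Conformal restriction: the chordal case*, J. Amer. Math.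
  Soc. **16** (2003) 917–955, arXiv:math/0209343 (**[LSW]**), Cor. 8.6 (p. 37) and its proof
  (p. 38), Prop. 4.1 (p. 16: the filling of the Brownian excursion from `0` to `∞` in `ℍ` has
  law `P_1`), Remark 3.7 (p. 14: reflection symmetry of `P_α`);
* G. F. Lawler, *Conformally Invariant Processes in the Plane*, AMS (2005) (**[Law05]**), §9.2
  Prop. 9.13 (p. 220) and the proof of Cor. 9.11 (p. 219): "The construction above shows that
  `q(α) ∈ (0, 1)`".

State of the tree. `RestrictionMeasuresFiveEighthsThreeLeaves` proves Cor. 8.6 from ONE input,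
a two-sided restriction measure `P` of exponent `1` ALMOST EVERY sample of which has an interior
point (`not_exists_isRestrictionMeasure_of_lt_five_eighths_of_exists_one_interior`): the
left-filled Poissonian cloud of hung `P`-samples is `P⁺_β` for every `β > 0`
(`ExcursionCloud.exists_isRightRestrictionMeasure_of_exists_one`, [Law05] Prop. 9.13), it
contains `i` with positive probability (`ExcursionCloud.measure_I_mem_cloudConfig_pos`), and
Lawler's Cor. 9.11 argument with `q(5/8) = 1/2` (a theorem) concludes. In that chain the
almost-everywhere hypothesis is used at exactly one place, `ExcursionCloud.exists_ball_re_neg_charged`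
("some disc of the open left quadrant lies in the sample with positive probability"), and there
only through `P{int K ≠ ∅} = 1 ≠ 0`. This file records the same chain under the WEAKER input

  `∃ P, IsRestrictionMeasure 1 P ∧ P {K | (interior K).Nonempty} ≠ 0`

— a two-sided `P_1` whose samples have an interior point with positive probability — which is what
a construction of `P_1` (the filled Brownian excursion, [LSW] Prop. 4.1) delivers from a single
positive-probability event, with no almost-sure upgrade (by the uniqueness of `P_1`, [LSW] Prop.
3.3, the two inputs are a posteriori equivalent, but the tree has no zero–one law for
restriction-invariant events). PROVED here:

* `ExcursionCloud.exists_ball_re_neg_charged_of_ball` — a charged disc anywhere in `ℍ` gives a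
  charged disc inside the open left quadrant (shift left if centred on the axis, reflect by
  [LSW] Rem. 3.7 if centred in the right quadrant, shrink);
* `ExcursionCloud.exists_ball_re_neg_charged_of_measure_ne_zero` — the same from
  `P{int K ≠ ∅} ≠ 0` (some rational disc is charged);
* `ExcursionCloud.measure_I_mem_cloudConfig_pos_of_ball` — the positivity `P'{i ∈ cloud} > 0`
  from a charged left-quadrant disc (the proof of `ExcursionCloud.measure_I_mem_cloudConfig_pos`
  verbatim after its first line), hence `…_of_measure_ne_zero`;
* `ExcursionCloud.exists_isRightRestrictionMeasure_charging_I_of_measure_ne_zero`,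
  `ExcursionCloud.small_exponent_positivity_of_measure_ne_zero` — for every `β > 0` a `P⁺_β`
  with `P⁺_β{i ∉ K} < 1`;
* `exists_isRightRestrictionMeasure_lt_five_eighths_of_exists_one_charged` (the Cor. 8.6 input)
  and **`not_exists_isRestrictionMeasure_of_lt_five_eighths_of_exists_one_charged`** — [LSW]
  Cor. 8.6 from a two-sided `P_1` charging `{int K ≠ ∅}`.

So the discharge `not_exists_isRestrictionMeasure_of_lt_five_eighths_holds` is the last theorem
applied to `⟨P, hP, h⟩` as soon as the tree has ANY `P` with `IsRestrictionMeasure 1 P` and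
`P {K | (interior K).Nonempty} ≠ 0` (equivalently, by `exists_ball_re_neg_charged_of_ball`, some
disc `B(d, r) ⊆ K` with positive probability).

Mathlib: `TopologicalSpace.exists_countable_dense`, `measure_biUnion_null_iff`,
`Real.exp_lt_one_iff`, `prob_compl_eq_one_sub`. Tree: the `ExcursionCloud` API of
`OneSidedExcursionCloud(Measure)`, `IsRestrictionMeasure.measure_preimage_reflect`,
`exists_isRightRestrictionMeasure_lt_five_eighths_of_exists_of_pos'`,
`not_exists_isRestrictionMeasure_of_lt_five_eighths_of_oneSided`.

## References

* [LSW] Cor. 8.6 (pp. 37–38), Prop. 4.1 (p. 16), Rem. 3.7 (p. 14), Prop. 3.3 (pp. 10–11).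
  [LawlerSchrammWerner2003Restriction]
* [Law05] §9.2 Prop. 9.13 (p. 220), Cor. 9.11 (p. 219). [Lawler2005]
-/

noncomputable section

open Set Filter Topology Complex MeasureTheory Metric
open UpperHalfPlane (upperHalfPlaneSet)
open Literature.Probability.Process (IsPoissonCloud exists_isPoissonCloud_holds)
open scoped ComplexConjugate ENNReal Pointwise

namespace Literature.Probability.RandomPlanarGeometry

namespace ExcursionCloud

/-! ### A charged disc in the open left quadrant from a positive-probability interior -/

section Charged

variable {P : Measure RestrictionConfig}

/-- **A charged disc anywhere gives a charged disc inside the open left quadrant**: if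
`B(d, r) ⊆ K` with positive `P`-probability for a two-sided restriction measure `P`, then some
disc contained in `{re < 0}` lies in `K` with positive probability — shrink if `re d < 0`, shift
the disc to the left inside itself if `re d = 0`, reflect in the imaginary axis if `re d > 0`
(`P` is `σ`-invariant, [LSW] Rem. 3.7; `IsRestrictionMeasure.measure_preimage_reflect`).
[cite: LawlerSchrammWerner2003Restriction, Remark 3.7 (p. 14)] -/
theorem exists_ball_re_neg_charged_of_ball {α : ℝ} (hP : IsRestrictionMeasure α P)
    {d : ℂ} {r : ℝ} (hr : 0 < r) (hpos : 0 < P {K : RestrictionConfig | ball d r ⊆ (K : Set ℂ)}) :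
    ∃ (q₀ : ℂ) (r₀ : ℝ), 0 < r₀ ∧ ball q₀ r₀ ⊆ {z : ℂ | z.re < 0} ∧
      0 < P {K : RestrictionConfig | ball q₀ r₀ ⊆ (K : Set ℂ)} := by
  rcases lt_trichotomy d.re 0 with hd | hd | hd
  · exact exists_ball_of_charged hr hd hpos
  · -- shift the disc to the left inside itself
    have hsub : ball (d - (r / 2 : ℝ)) (r / 2) ⊆ ball d r := by
      intro w hw
      rw [mem_ball] at hw ⊢
      calc dist w d ≤ dist w (d - (r / 2 : ℝ)) + dist (d - ((r / 2 : ℝ) : ℂ)) d := dist_triangle _ _ _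
        _ < r / 2 + r / 2 := by
            have : dist (d - ((r / 2 : ℝ) : ℂ)) d = r / 2 := by
              rw [dist_eq_norm, sub_sub_cancel_left, norm_neg, Complex.norm_real, Real.norm_eq_abs,
                abs_of_pos (half_pos hr)]
            linarith
        _ = r := by ring
    have hre : (d - ((r / 2 : ℝ) : ℂ)).re < 0 := by
      rw [Complex.sub_re, Complex.ofReal_re, hd]
      linarith
    exact exists_ball_of_charged (half_pos hr) hre (hpos.trans_le (measure_mono fun K hK ↦ hsub.trans hK))
  · -- reflect
    have hpos' : 0 < P {K : RestrictionConfig | ball (imagAxisRefl d) r ⊆ (K : Set ℂ)} := by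
      rw [← reflect_preimage_ball_subset, hP.measure_preimage_reflect (RestrictionConfig.measurableSet_ball_subset d r)]
      exact hpos
    exact exists_ball_of_charged hr (by rw [imagAxisRefl_re]; linarith) hpos'

/-- **A two-sided restriction measure charging `{int K ≠ ∅}` charges some disc of the open left
quadrant**: the configurations with an interior point are covered by the countably many events
"`K` contains the rational disc `B(d, 1/(m+1))`", so one of them has positive probability
(this is `exists_ball_re_neg_charged` with its almost-everywhere hypothesis weakened to positive
probability — the only form in which that proof uses it). [cite: LawlerSchrammWerner2003Restriction, Remark 3.7 (p. 14)] -/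
theorem exists_ball_re_neg_charged_of_measure_ne_zero {α : ℝ} (hP : IsRestrictionMeasure α P)
    (hint : P {K : RestrictionConfig | (interior (K : Set ℂ)).Nonempty} ≠ 0) :
    ∃ (q₀ : ℂ) (r₀ : ℝ), 0 < r₀ ∧ ball q₀ r₀ ⊆ {z : ℂ | z.re < 0} ∧
      0 < P {K : RestrictionConfig | ball q₀ r₀ ⊆ (K : Set ℂ)} := by
  obtain ⟨D, hDc, hDd⟩ := TopologicalSpace.exists_countable_dense ℂ
  -- every configuration with an interior point contains a rational disc
  have hcov : {K : RestrictionConfig | (interior (K : Set ℂ)).Nonempty} ⊆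
      ⋃ d ∈ D, ⋃ m : ℕ, {K : RestrictionConfig | ball d (1 / ((m : ℝ) + 1)) ⊆ (K : Set ℂ)} := by
    rintro K ⟨z, hz⟩
    rw [mem_interior_iff_mem_nhds, Metric.mem_nhds_iff] at hz
    obtain ⟨ε, hε, hball⟩ := hz
    obtain ⟨m, hm⟩ := exists_nat_one_div_lt (half_pos hε)
    have hpos : (0 : ℝ) < 1 / ((m : ℝ) + 1) := by positivity
    obtain ⟨d, hdD, hdz⟩ := hDd.exists_dist_lt z hpos
    refine mem_iUnion₂.2 ⟨d, hdD, mem_iUnion.2 ⟨m, fun w hw ↦ hball ?_⟩⟩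
    rw [mem_ball] at hw ⊢
    calc dist w z ≤ dist w d + dist d z := dist_triangle _ _ _
      _ < 1 / ((m : ℝ) + 1) + 1 / ((m : ℝ) + 1) := by rw [dist_comm d z]; linarith
      _ < ε := by linarith
  -- some rational disc is charged
  have hex : ∃ d ∈ D, ∃ m : ℕ, 0 < P {K : RestrictionConfig | ball d (1 / ((m : ℝ) + 1)) ⊆ (K : Set ℂ)} := by
    by_contra h
    push Not at h
    have hnull : P (⋃ d ∈ D, ⋃ m : ℕ, {K : RestrictionConfig | ball d (1 / ((m : ℝ) + 1)) ⊆ (K : Set ℂ)}) = 0 :=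
      (measure_biUnion_null_iff hDc).2 fun d hd ↦ measure_iUnion_null_iff.2 fun m ↦
        nonpos_iff_eq_zero.1 (h d hd m)
    exact hint (measure_mono_null hcov hnull)
  obtain ⟨d, -, m, hpos⟩ := hex
  exact exists_ball_re_neg_charged_of_ball hP (by positivity) hpos

end Charged

/-! ### Positivity of `{i ∈ cloud}` from a charged left-quadrant disc -/

section Positivity

variable {P : Measure RestrictionConfig}
variable {Ω' : Type*} [MeasurableSpace Ω'] {P' : Measure Ω'} {X : Ω' → Set (((ℝ × ℝ) × ℝ) × RestrictionConfig)}
  {β : ℝ}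

/-- **`P'{i ∈ left-filled cloud} > 0` from a charged disc of the open left quadrant** ([Law05]
proof of Cor. 9.11, positivity half; the proof of `measure_I_mem_cloudConfig_pos` after its first
line): the parameters carrying `i` into the disc `B(q₀, r₀) ⊆ {re < 0}` form a nonempty open set
`U` (`exists_goodParams_eq`), and the cloud has a point in `U × {B(q₀, r₀) ⊆ K}` with probability
`1 − exp(−Λ_β(U × {B(q₀, r₀) ⊆ K})) > 0`. [cite: Lawler2005, Cor. 9.11 (proof, p. 219) with §9.2 Prop. 9.13] -/
theorem measure_I_mem_cloudConfig_pos_of_ball (hP : IsRestrictionMeasure 1 P)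
    {q₀ : ℂ} {r₀ : ℝ} (hr₀ : 0 < r₀) (hsub : ball q₀ r₀ ⊆ {z : ℂ | z.re < 0})
    (hVpos : 0 < P {K : RestrictionConfig | ball q₀ r₀ ⊆ (K : Set ℂ)})
    (hβ : 0 < β) (hX : IsPoissonCloud (cloudIntensity β P) X P') :
    0 < P' {ω | Complex.I ∈ ((cloudConfig X ω : RightConfig) : Set ℂ)} := by
  haveI := hP.isProbabilityMeasure
  haveI := hX.isProbabilityMeasure
  -- `q₀ ∈ ℍ`: some configuration contains the disc
  have hq₀ : 0 < q₀.im := by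
    obtain ⟨K, hK⟩ := nonempty_of_measure_ne_zero hVpos.ne'
    exact K.subset_upperHalfPlaneSet (hK (mem_ball_self hr₀))
  obtain ⟨qs, hqs, hζ⟩ := exists_goodParams_eq (hsub (mem_ball_self hr₀)) hq₀
  set ζ : (ℝ × ℝ) × ℝ → ℂ := fun q ↦ (q.2 : ℂ) * excInv (min q.1.1 q.1.2) (max q.1.1 q.1.2) Complex.I with hζdef
  set U : Set ((ℝ × ℝ) × ℝ) := goodParams ∩ ζ ⁻¹' ball q₀ r₀ with hU
  set V : Set RestrictionConfig := {K | ball q₀ r₀ ⊆ (K : Set ℂ)} with hV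
  have hUo : IsOpen U := isOpen_goodParams.inter (continuous_hungPoint_I.isOpen_preimage _ isOpen_ball)
  have hUne : U.Nonempty := ⟨qs, hqs, by rw [mem_preimage, hζdef]; simp only; rw [hζ]; exact mem_ball_self hr₀⟩
  have hUm : MeasurableSet U := hUo.measurableSet
  have hVm : MeasurableSet V := RestrictionConfig.measurableSet_ball_subset q₀ r₀
  have hs : MeasurableSet (U ×ˢ V) := hUm.prod hVm
  -- a cloud point in `U × V` puts `i` in the cloud
  have hkey : {ω | X ω ∩ (U ×ˢ V) ≠ ∅} ∩ goodSet X ⊆ {ω | Complex.I ∈ ((cloudConfig X ω : RightConfig) : Set ℂ)} := by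
    rintro ω ⟨hne, hω⟩
    obtain ⟨e, he, heU, heV⟩ := nonempty_iff_ne_empty.2 hne
    exact I_mem_cloudConfig_of_mem hω he (heV (mem_preimage.1 heU.2))
  -- the probability of a cloud point in `U × V` is positive
  have hΛpos : 0 < cloudIntensity β P (U ×ˢ V) := by
    rw [cloudIntensity_prod]
    exact ENNReal.mul_pos (paramMeasure_pos_of_isOpen hβ hUo inter_subset_left hUne).ne' hVpos.ne'
  have hempty : P' {ω | X ω ∩ (U ×ˢ V) = ∅} < 1 := by
    by_cases htop : cloudIntensity β P (U ×ˢ V) = ∞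
    · have hae := hX.ae_encard_eq_top hs htop
      have h0 : P' {ω | X ω ∩ (U ×ˢ V) = ∅} = 0 := by
        rw [ae_iff] at hae
        refine measure_mono_null (fun ω hω ↦ ?_) hae
        simp only [mem_setOf_eq] at hω ⊢
        rw [hω]
        simp
      rw [h0]
      exact zero_lt_one
    · rw [hX.measure_inter_eq_empty hs htop]
      rw [← ENNReal.ofReal_one]
      refine (ENNReal.ofReal_lt_ofReal_iff zero_lt_one).2 ?_
      rw [Real.exp_lt_one_iff]
      exact neg_neg_of_pos (ENNReal.toReal_pos hΛpos.ne' htop)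
  have hpos : 0 < P' {ω | X ω ∩ (U ×ˢ V) ≠ ∅} := by
    have : {ω | X ω ∩ (U ×ˢ V) ≠ ∅} = {ω | X ω ∩ (U ×ˢ V) = ∅}ᶜ := rfl
    rw [this, prob_compl_eq_one_sub (hX.measurableSet_inter_eq_empty hs)]
    exact tsub_pos_iff_lt.2 hempty
  -- discard the null set of bad samples
  have hgood : P' (goodSet X)ᶜ = 0 := by
    have := ae_mem_goodSet hP hβ.le hX
    rwa [ae_iff] at this
  calc (0 : ℝ≥0∞) < P' {ω | X ω ∩ (U ×ˢ V) ≠ ∅} := hpos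
    _ = P' ({ω | X ω ∩ (U ×ˢ V) ≠ ∅} ∩ goodSet X) := (measure_inter_conull hgood).symm
    _ ≤ _ := measure_mono hkey

/-- **`P'{i ∈ left-filled cloud} > 0`** when the two-sided `P_1` charges `{int K ≠ ∅}` with
positive probability (`measure_I_mem_cloudConfig_pos` with its almost-everywhere hypothesis
weakened). [cite: Lawler2005, Cor. 9.11 (proof, p. 219) with §9.2 Prop. 9.13] -/
theorem measure_I_mem_cloudConfig_pos_of_measure_ne_zero (hP : IsRestrictionMeasure 1 P)
    (hint : P {K : RestrictionConfig | (interior (K : Set ℂ)).Nonempty} ≠ 0)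
    (hβ : 0 < β) (hX : IsPoissonCloud (cloudIntensity β P) X P') :
    0 < P' {ω | Complex.I ∈ ((cloudConfig X ω : RightConfig) : Set ℂ)} := by
  obtain ⟨q₀, r₀, hr₀, hsub, hVpos⟩ := exists_ball_re_neg_charged_of_measure_ne_zero hP hint
  exact measure_I_mem_cloudConfig_pos_of_ball hP hr₀ hsub hVpos hβ hX

end Positivity

/-! ### For every `β > 0` a `P⁺_β` charging `i` -/

section Final

/-- **For every `β > 0` some right-sided restriction measure of exponent `β` has
`P⁺_β{i ∉ K} < 1`**, given a two-sided restriction measure of exponent `1` charging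
`{int K ≠ ∅}` with positive probability (the law of the left-filled Poissonian cloud of hung
samples, [Law05] Prop. 9.13, with `measure_I_mem_cloudConfig_pos_of_measure_ne_zero`).
[cite: Lawler2005, Cor. 9.11 (proof, p. 219) with §9.2 Prop. 9.13 (p. 220)] -/
theorem exists_isRightRestrictionMeasure_charging_I_of_measure_ne_zero
    (h1 : ∃ P : Measure RestrictionConfig, IsRestrictionMeasure 1 P ∧
      P {K : RestrictionConfig | (interior (K : Set ℂ)).Nonempty} ≠ 0) {β : ℝ} (hβ : 0 < β) :
    ∃ Q : Measure RightConfig, IsRightRestrictionMeasure β Q ∧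
      Q {K : RightConfig | Complex.I ∉ (K : Set ℂ)} < 1 := by
  obtain ⟨P, hP, hint⟩ := h1
  haveI := hP.isProbabilityMeasure
  obtain ⟨Ω', _, P', X, hX⟩ := exists_isPoissonCloud_holds (cloudIntensity β P) measurableSet_diagonal_cloudSpace
    inferInstance (cloudIntensity_singleton β P)
  haveI := hX.isProbabilityMeasure
  have hmeas := measurable_cloudConfig hX (P := P)
  refine ⟨P'.map (cloudConfig X), isRightRestrictionMeasure_map_cloudConfig hP hβ.le hX, ?_⟩
  have hI : (Complex.I : ℂ) ∈ upperHalfPlaneSet := by simp [upperHalfPlaneSet]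
  rw [Measure.map_apply hmeas (RightConfig.measurableSet_notMem hI)]
  have hset : cloudConfig X ⁻¹' {K : RightConfig | Complex.I ∉ (K : Set ℂ)} =
      {ω | Complex.I ∈ ((cloudConfig X ω : RightConfig) : Set ℂ)}ᶜ := by
    ext ω
    simp
  have hm : MeasurableSet {ω | Complex.I ∈ ((cloudConfig X ω : RightConfig) : Set ℂ)} := by
    have := (hmeas (RightConfig.measurableSet_notMem hI)).compl
    rwa [hset, compl_compl] at this
  rw [hset, prob_compl_eq_one_sub hm]
  exact ENNReal.sub_lt_self ENNReal.one_ne_top one_ne_zero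
    (measure_I_mem_cloudConfig_pos_of_measure_ne_zero hP hint hβ hX).ne'

/-- The same in the `ε`-form consumed by the tree's reductions (`…_of_exists_of_pos'`): for every
`ε > 0` some `P⁺_β`, `0 < β ≤ ε`, gives `{i ∉ K}` probability `< 1`. [cite: Lawler2005, Cor. 9.11 (proof, p. 219)] -/
theorem small_exponent_positivity_of_measure_ne_zero
    (h1 : ∃ P : Measure RestrictionConfig, IsRestrictionMeasure 1 P ∧
      P {K : RestrictionConfig | (interior (K : Set ℂ)).Nonempty} ≠ 0) :
    ∀ ε : ℝ, 0 < ε → ∃ (β : ℝ) (Q : Measure RightConfig), 0 < β ∧ β ≤ ε ∧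
      IsRightRestrictionMeasure β Q ∧ Q {K : RightConfig | Complex.I ∉ (K : Set ℂ)} < 1 := by
  intro ε hε
  obtain ⟨Q, hQ, hlt⟩ := exists_isRightRestrictionMeasure_charging_I_of_measure_ne_zero h1 hε
  exact ⟨ε, Q, hε, le_rfl, hQ, hlt⟩

end Final

end ExcursionCloud

/-! ### The Cor. 8.6 input and Cor. 8.6 from a `P_1` charging the interior event -/

/-- **The Cor. 8.6 input `exists_isRightRestrictionMeasure_lt_five_eighths` from one two-sided
restriction measure of exponent `1` charging `{int K ≠ ∅}` with positive probability**
(existence of all `P⁺_β` by the excursion cloud, positivity by the above, `q(5/8) = 1/2` by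
Thm. 6.1 — `exists_isRightRestrictionMeasure_lt_five_eighths_of_exists_of_pos'`).
[cite: Lawler2005, Cor. 9.11 (p. 219) with §9.2 Prop. 9.13 (p. 220); LawlerSchrammWerner2003Restriction, proof of Cor. 8.6 (p. 38)] -/
theorem exists_isRightRestrictionMeasure_lt_five_eighths_of_exists_one_charged
    (h1 : ∃ P : Measure RestrictionConfig, IsRestrictionMeasure 1 P ∧
      P {K : RestrictionConfig | (interior (K : Set ℂ)).Nonempty} ≠ 0) :
    exists_isRightRestrictionMeasure_lt_five_eighths :=
  exists_isRightRestrictionMeasure_lt_five_eighths_of_exists_of_pos'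
    (exists_isRightRestrictionMeasure_of_exists_restrictionMeasure_one (h1.imp fun _ h ↦ h.1))
    (ExcursionCloud.small_exponent_positivity_of_measure_ne_zero h1)

/-- **[LSW] Cor. 8.6 from one two-sided restriction measure of exponent `1` whose samples have
an interior point with positive probability** (in [LSW]/[Law05] the filled Brownian excursion,
Prop. 4.1; Cor. 9.11 as printed, "the construction above" being the excursion cloud). The
discharge `not_exists_isRestrictionMeasure_of_lt_five_eighths_holds` is this theorem applied to
any such `P` once the tree has one.
[cite: LawlerSchrammWerner2003Restriction, Cor. 8.6 (pp. 37–38) with Prop. 4.1 (p. 16); Lawler2005, Cor. 9.11 (p. 219)] -/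
theorem not_exists_isRestrictionMeasure_of_lt_five_eighths_of_exists_one_charged
    (h1 : ∃ P : Measure RestrictionConfig, IsRestrictionMeasure 1 P ∧
      P {K : RestrictionConfig | (interior (K : Set ℂ)).Nonempty} ≠ 0) :
    not_exists_isRestrictionMeasure_of_lt_five_eighths :=
  not_exists_isRestrictionMeasure_of_lt_five_eighths_of_oneSided
    (exists_isRightRestrictionMeasure_lt_five_eighths_of_exists_one_charged h1)

/-- The disc form: **[LSW] Cor. 8.6 from a two-sided `P_1` under which some disc `B(d, r)`,
`r > 0`, lies in the sample with positive probability.**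
[cite: LawlerSchrammWerner2003Restriction, Cor. 8.6 (pp. 37–38) with Prop. 4.1 (p. 16); Lawler2005, Cor. 9.11 (p. 219)] -/
theorem not_exists_isRestrictionMeasure_of_lt_five_eighths_of_exists_one_ball
    (h1 : ∃ P : Measure RestrictionConfig, IsRestrictionMeasure 1 P ∧
      ∃ (d : ℂ) (r : ℝ), 0 < r ∧ 0 < P {K : RestrictionConfig | ball d r ⊆ (K : Set ℂ)}) :
    not_exists_isRestrictionMeasure_of_lt_five_eighths := by
  obtain ⟨P, hP, d, r, hr, hpos⟩ := h1
  refine not_exists_isRestrictionMeasure_of_lt_five_eighths_of_exists_one_charged ⟨P, hP, fun h0 ↦ ?_⟩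
  -- a configuration containing a disc has an interior point
  have hsub : {K : RestrictionConfig | ball d r ⊆ (K : Set ℂ)} ⊆
      {K : RestrictionConfig | (interior (K : Set ℂ)).Nonempty} := fun K hK ↦
    ⟨d, interior_mono hK (by rw [isOpen_ball.interior_eq]; exact mem_ball_self hr)⟩
  exact hpos.ne' (measure_mono_null hsub h0)

end Literature.Probability.RandomPlanarGeometry

end
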